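import Mathlib
import Summits.Ventures.DiscreteObjects.Mahler.CyclotomicIntegerLehmer
import Summits.Ventures.DiscreteObjects.Mahler.GoldenRatioSharpness

/-!
# Sharpness of Schinzel's bound for cyclotomic integers: `α = 1 + ζ₅ + ζ₅⁴ = φ` (venture `DiscreteObjects`, target L)

Cell `pub-namedobj`, seat `pub-namedobj-mahler-g28`. Framing: lottery ticket; floor = certified bounds/negative ranges.

Companion of `CyclotomicIntegerSchinzel` / `CyclotomicIntegerSchinzelMeasure` (Schinzel 1973: `φ^{deg α} ≤ M(α)²` for every
nonzero non-torsion cyclotomic integer): the bound is an EQUALITY for the cyclotomic integer `α = 1 + ζ₅ + ζ₅⁴ ∈ ℤ[ζ₅]`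
(`= 1 + 2cos(2π/5) = φ`): `minpoly_ℤ α = x² - x - 1` (`minpoly_one_add_zeta_five`: `α² - α - 1 = Φ₅(ζ)·(…) = 0`, and
`x² - x - 1` has no integer root by parity), `M(x² - x - 1) = φ` (`GoldenRatioSharpness`; [cite: MckeeSmyth2021, Exercise 14.11] for
Schinzel's theorem), so `M(α)² = φ² = φ^{deg α}` (`schinzel_cyclotomicInteger_sharp`).  Bookkeeping; no new mathematics.
-/

namespace Summit.Ventures.DiscreteObjects.Mahler

open Polynomial

/-- `α = 1 + ζ + ζ⁴` for a primitive fifth root of unity `ζ` satisfies `α² - α - 1 = 0` (it is the golden ratio or its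
conjugate). -/
theorem aeval_goldenPoly_one_add_zeta_five {ζ : ℂ} (hζ : IsPrimitiveRoot ζ 5) :
    aeval (aeval ζ (1 + X + X ^ 4 : ℤ[X])) (X ^ 2 - X - 1 : ℤ[X]) = 0 := by
  have h5 : ζ ^ 5 = 1 := hζ.pow_eq_one
  have hsum : 1 + ζ + ζ ^ 2 + ζ ^ 3 + ζ ^ 4 = 0 := by
    have h := hζ.geom_sum_eq_zero (by norm_num : 1 < 5)
    simpa [Finset.sum_range_succ, pow_succ] using h
  simp only [map_add, map_sub, map_pow, map_one, aeval_X]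
  have h8 : ζ ^ 8 = ζ ^ 3 := by
    calc ζ ^ 8 = ζ ^ 5 * ζ ^ 3 := by ring
      _ = ζ ^ 3 := by rw [h5, one_mul]
  have e : (1 + ζ + ζ ^ 4) ^ 2 - (1 + ζ + ζ ^ 4) - 1 =
      (1 + ζ + ζ ^ 2 + ζ ^ 3 + ζ ^ 4) + (ζ ^ 8 - ζ ^ 3) + 2 * (ζ ^ 5 - 1) := by ring
  rw [e, hsum, h8, h5]; ring

/-- The minimal polynomial of `1 + ζ₅ + ζ₅⁴` is `x² - x - 1`. -/
theorem minpoly_one_add_zeta_five {ζ : ℂ} (hζ : IsPrimitiveRoot ζ 5) :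
    minpoly ℤ (aeval ζ (1 + X + X ^ 4 : ℤ[X])) = X ^ 2 - X - 1 := by
  set α : ℂ := aeval ζ (1 + X + X ^ 4 : ℤ[X]) with hα
  have hζint : IsIntegral ℤ ζ := hζ.isIntegral (by norm_num)
  have hαint : IsIntegral ℤ α := by
    have hmem : α ∈ Algebra.adjoin ℤ {ζ} := Polynomial.aeval_mem_adjoin_singleton ℤ ζ
    exact (mem_integralClosure_iff ℤ ℂ).1 (adjoin_le_integralClosure hζint hmem)
  set P : ℤ[X] := X ^ 2 - X - 1 with hP
  have hPmon : P.Monic := by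
    rw [hP, show (X ^ 2 - X - 1 : ℤ[X]) = X ^ 2 - (X + 1) by ring]
    exact monic_X_pow_sub (by
      calc (X + 1 : ℤ[X]).degree ≤ 1 := by compute_degree
        _ < 2 := by norm_num)
  have hPdeg : P.natDegree = 2 := by rw [hP]; compute_degree!
  have hdvd : minpoly ℤ α ∣ P := minpoly.isIntegrallyClosed_dvd hαint (aeval_goldenPoly_one_add_zeta_five hζ)
  have hmon : (minpoly ℤ α).Monic := minpoly.monic hαint
  -- the degree of the minimal polynomial is `2`: it is `≤ 2` and not `1` (no integer root of `x² - x - 1`)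
  have hle : (minpoly ℤ α).natDegree ≤ 2 := hPdeg ▸ natDegree_le_of_dvd hdvd hPmon.ne_zero
  have hpos : 0 < (minpoly ℤ α).natDegree := minpoly.natDegree_pos hαint
  have hne1 : (minpoly ℤ α).natDegree ≠ 1 := by
    intro h1
    have hf1 := hmon.eq_X_add_C h1
    set c : ℤ := (minpoly ℤ α).coeff 0 with hc
    have hαc : α = -(c : ℂ) := by
      have h := minpoly.aeval ℤ α
      rw [hf1, map_add, aeval_X, aeval_C, algebraMap_int_eq, eq_intCast] at h
      linear_combination h
    have hroot := aeval_goldenPoly_one_add_zeta_five hζ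
    rw [← hα, hαc] at hroot
    simp only [map_sub, map_pow, map_one, aeval_X] at hroot
    have hint : ((c ^ 2 + c - 1 : ℤ) : ℂ) = 0 := by push_cast; linear_combination hroot
    have hc0 : c ^ 2 + c - 1 = 0 := by exact_mod_cast hint
    have hev : Even (c * (c + 1)) := Int.even_mul_succ_self c
    rcases hev with ⟨r, hr⟩
    have h2 : c * (c + 1) = 1 := by linear_combination hc0
    rw [h2] at hr
    omega
  have hdeg : (minpoly ℤ α).natDegree = 2 := by omega
  exact (eq_of_monic_of_dvd_of_natDegree_le hmon hPmon hdvd (by rw [hPdeg, hdeg])).symm ▸ rfl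

/-- **Schinzel's bound for cyclotomic integers is sharp**: for `α = 1 + ζ₅ + ζ₅⁴ = φ ∈ ℤ[ζ₅]` (nonzero, not a root of
unity, degree `2`) one has `M(α)² = φ² = φ^{deg α}`. -/
theorem schinzel_cyclotomicInteger_sharp {ζ : ℂ} (hζ : IsPrimitiveRoot ζ 5) :
    aeval ζ (1 + X + X ^ 4 : ℤ[X]) ≠ 0 ∧ (∀ k : ℕ, 0 < k → aeval ζ (1 + X + X ^ 4 : ℤ[X]) ^ k ≠ 1) ∧
      (minpoly ℤ (aeval ζ (1 + X + X ^ 4 : ℤ[X]))).natDegree = 2 ∧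
      intMahlerMeasure (minpoly ℤ (aeval ζ (1 + X + X ^ 4 : ℤ[X]))) ^ 2 =
        Real.goldenRatio ^ (minpoly ℤ (aeval ζ (1 + X + X ^ 4 : ℤ[X]))).natDegree := by
  have hmin := minpoly_one_add_zeta_five hζ
  have hdeg : (minpoly ℤ (aeval ζ (1 + X + X ^ 4 : ℤ[X]))).natDegree = 2 := by rw [hmin]; compute_degree!
  have hM : intMahlerMeasure (minpoly ℤ (aeval ζ (1 + X + X ^ 4 : ℤ[X]))) = Real.goldenRatio := by
    rw [hmin]; exact intMahlerMeasure_X_sq_sub_X_sub_one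
  set α : ℂ := aeval ζ (1 + X + X ^ 4 : ℤ[X]) with hα
  have hζint : IsIntegral ℤ ζ := hζ.isIntegral (by norm_num)
  have hαint : IsIntegral ℤ α := by
    have hmem : α ∈ Algebra.adjoin ℤ {ζ} := Polynomial.aeval_mem_adjoin_singleton ℤ ζ
    exact (mem_integralClosure_iff ℤ ℂ).1 (adjoin_le_integralClosure hζint hmem)
  refine ⟨?_, ?_, hdeg, by rw [hM, hdeg]⟩
  · intro h0
    have h := aeval_goldenPoly_one_add_zeta_five hζ
    rw [← hα, h0] at h
    simp at h
  · intro k hk hk1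
    -- a root of unity has a cyclotomic minimal polynomial, of Mahler measure `1 ≠ φ`
    have hfin : IsOfFinOrder α := isOfFinOrder_iff_pow_eq_one.2 ⟨k, hk, hk1⟩
    have hj : 0 < orderOf α := hfin.orderOf_pos
    have hprim : IsPrimitiveRoot α (orderOf α) := IsPrimitiveRoot.orderOf α
    have hcyc : cyclotomic (orderOf α) ℤ = minpoly ℤ α := cyclotomic_eq_minpoly hprim hj
    have h1 : intMahlerMeasure (minpoly ℤ α) = 1 := by rw [← hcyc]; exact intMahlerMeasure_cyclotomic _
    rw [hα] at h1
    rw [h1] at hM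
    exact (Real.one_lt_goldenRatio).ne hM

end Summit.Ventures.DiscreteObjects.Mahler
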